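/-
Copyright (c) 2026 the pub-hodgecm-mathlib formalisation cell (harness21).  Prover seat hodgecm-mathlib-K2Liu-p10 (g3), Track B «K2-LIT»,
#184♮ = hLiu418 = `stmt-HodgeConjecture-24832`; Road Φ of socket #41, organ «Φ4-exact», method «E-det» (LEAD F0P6-plan (g13) 09:54:17Z ∕ 09:57:20Z ∕
10:02:45Z; K2Liu-p12 (g2) interface 10:04:15Z): E4 file 2b-i — RESIDUE-FIELD AND COSET PRELIMINARIES over `F_v` for the split-place value `I(1,1)`.
THEOREMS ONLY (no `def`, no `instance`, no named-fact hypothesis, no `sorry`).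
-/
import Summits.HodgeConjecture.HodgeConjecture.Theorems.K2LiuSkewLatticeShells                  -- ★ measure-theory frame, `AddCharConductorExponent`
import Literature.NumberTheory.Automorphic.AdicCompletionResidueCard                             -- ★ `|𝓀(F_v)| = q_v`
import Literature.NumberTheory.Automorphic.UnitaryLatticeTreeResiduallyUnipotentCorner           -- ★ `residue_eq_zero_iff_v_lt_one`, `v_lt_one_iff`
import HarnessLib

/-!
# Crux `HLiu418`, Road Φ, organ «Φ4-exact» (E-det), E4 file 2b-i: COSET INTEGRALS, THE RESIDUE FIELD `𝓀(F_v)` AND THE CHARACTER `ψ₀(x̄) = ψ(−2ϖ⁻¹x)`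

Cell `hodgecm-mathlib`, crux item hLiu418 = `stmt-HodgeConjecture-24832` (helper lane, count-neutral).  Everything here lives over ONE local field
`F_v = v.adicCompletion F` (Mathlib's `Valued` spelling `𝒪[F_v]`, `𝓀[F_v]`), plus one generic measure-theoretic lemma:
* `setIntegral_eq_sum_cosets` — a set integral over a finite union of cosets `ρ_k + H` of a function constant on cosets is `Σ_k 𝟙_D(ρ_k) f(ρ_k) μ(H)`;
* `natCard_residueField_eq`, `finite_residueField` — `|𝓀(F_v)| = q_v` (★ `AdicCompletionResidueCard`);
* `v_lt_one_iff_le`, `uniformizer_facts`, `residue_eq_iff` — discreteness bookkeeping for `|ϖ| = exp(−1)`;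
* **`exists_addChar_residue`** — for `ψ` of conductor exponent `0` and `2 ∈ 𝒪^×`, a NON-TRIVIAL `ψ₀ : AddChar 𝓀(F_v) ℂ` with `ψ₀(x̄) = ψ(−2ϖ⁻¹x)`;
* `valued_det_trace_le_one`, `valued_det_smul_inv_le_iff`, **`valued_det_coset_le_iff`** (`|det(ϖ⁻¹s(κ) + H)| ≤ |ϖ|⁻¹ ↔ det κ = 0`),
  **`addChar_trace_coset_eq`** (`ψ(−2tr(b(ϖ⁻¹s(κ) + H))) = ψ₀(tr(b̄κ))`) — the two coset computations in `M₂(F_v)`.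
Consumer: ★ E4 file 2b-ii `K2LiuSkewResidueQuadricSplit` (the value `I(1,1) = −q_v μ(B(0))` at a split place).
Sources: [Tate1950, §2.2]; [KudlaRallis1994, §2]; [LidlNiederreiter1997, Ch. 5]; [CasselsFrohlichANT1967, Ch. II §10].
HONEST LABEL.  Helper lemmas, count-neutral; `HC_CM` is proved only modulo the 7 printed citations (2 remaining named inputs:
hLiu418 = `stmt-HodgeConjecture-24832`, h413 = `stmt-HodgeConjecture-24833`) until rung 0 closes.
-/

set_option autoImplicit false
set_option linter.dupNamespace false -- the mandated namespace repeats `HodgeConjecture.HodgeConjecture`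

noncomputable section

open scoped Matrix Valued
open NumberField IsDedekindDomain Matrix MeasureTheory
open Literature.NumberTheory.Automorphic

namespace Summit.HodgeConjecture.HodgeConjecture.Cruxes.HLiu418.K2LiuResidueCharacterCosets

/-! ## 1. A set integral over finitely many cosets -/

/-- **Integration over a finite union of cosets.**  `H ≤ S` a measurable subgroup of finite measure, `μ` left-invariant, `ρ : ι → S` representatives of
DISTINCT cosets whose union is `A`, `f` constant on each coset `ρ_k + H`, `D` a union of cosets: `∫_{A ∩ D} f = Σ_k 𝟙_D(ρ_k) f(ρ_k) · μ(H)`.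
[cite: Tate1950, §2.2, Lemma 2.2.5] -/
theorem setIntegral_eq_sum_cosets {S : Type*} [AddCommGroup S] [MeasurableSpace S] [MeasurableAdd S] (μ : Measure S) [μ.IsAddLeftInvariant]
    {ι : Type*} [Fintype ι] (H : AddSubgroup S) (hHm : MeasurableSet (H : Set S)) (hHμ : μ H ≠ ⊤) (ρ : ι → S) (A D : Set S) (f : S → ℂ)
    (hcover : ∀ t ∈ A, ∃ k, -ρ k + t ∈ H) (hA : ∀ k h, h ∈ H → ρ k + h ∈ A) (hdisj : ∀ k k', -ρ k' + ρ k ∈ H → k = k')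
    (hf : ∀ k h, h ∈ H → f (ρ k + h) = f (ρ k)) (hD : ∀ k h, h ∈ H → (ρ k + h ∈ D ↔ ρ k ∈ D)) :
    ∫ t in A ∩ D, f t ∂μ = ∑ k, D.indicator f (ρ k) * (μ.real H : ℂ) := by
  classical
  set s : ι → Set S := fun k => ((fun t => -ρ k + t) ⁻¹' (H : Set S)) ∩ {_t | ρ k ∈ D} with hs_def
  have hsm : ∀ k, MeasurableSet (s k) := fun k => ((measurable_const_add (-ρ k)) hHm).inter (MeasurableSet.const _)
  have hdecomp : ∀ k (t : S), t = ρ k + (-ρ k + t) := fun k t => by abel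
  have hAD : A ∩ D = ⋃ k, s k := by
    ext t
    simp only [Set.mem_inter_iff, Set.mem_iUnion, hs_def, Set.mem_preimage, Set.mem_setOf_eq, SetLike.mem_coe]
    constructor
    · rintro ⟨htA, htD⟩
      obtain ⟨k, hk⟩ := hcover t htA
      refine ⟨k, hk, ?_⟩
      rw [hdecomp k t] at htD
      exact (hD k _ hk).1 htD
    · rintro ⟨k, hk, hkD⟩
      rw [hdecomp k t]
      exact ⟨hA k _ hk, (hD k _ hk).2 hkD⟩
  have hdis : Pairwise (Function.onFun Disjoint s) := by
    intro k k' hkk'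
    rw [Function.onFun, Set.disjoint_left]
    rintro t ⟨hk, -⟩ ⟨hk', -⟩
    have h : -ρ k' + t - (-ρ k + t) ∈ H := H.sub_mem hk' hk
    rw [show -ρ k' + t - (-ρ k + t) = -ρ k' + ρ k by abel] at h
    exact hkk' (hdisj k k' h)
  -- the value on each piece
  have hcos : ∀ k, μ ((fun t => -ρ k + t) ⁻¹' (H : Set S)) = μ H := fun k => measure_preimage_add μ (-ρ k) _
  have hpiece : ∀ k, ∫ t in s k, f t ∂μ = D.indicator f (ρ k) * (μ.real H : ℂ) := by
    intro k
    by_cases hkD : ρ k ∈ D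
    · have hsk : s k = (fun t => -ρ k + t) ⁻¹' (H : Set S) := by
        rw [hs_def]; exact Set.inter_eq_left.2 fun _ _ => hkD
      rw [hsk, Set.indicator_of_mem hkD, setIntegral_congr_fun ((measurable_const_add (-ρ k)) hHm)
        (fun t (ht : -ρ k + t ∈ (H : Set S)) => show f t = f (ρ k) by rw [hdecomp k t]; exact hf k _ ht), setIntegral_const,
        Complex.real_smul, mul_comm, measureReal_def, measureReal_def, hcos k]
    · have hsk : s k = ∅ := by
        rw [hs_def]; exact Set.eq_empty_of_forall_notMem fun t ht => hkD ht.2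
      rw [hsk, Set.indicator_of_notMem hkD, setIntegral_empty, zero_mul]
  rw [hAD, integral_iUnion_fintype hsm hdis fun k => ?_]
  · exact Finset.sum_congr rfl fun k _ => hpiece k
  · -- integrable: constant on a set of finite measure
    have hfin : μ (s k) ≠ ⊤ := ne_top_of_le_ne_top hHμ ((measure_mono Set.inter_subset_left).trans (hcos k).le)
    exact (integrableOn_const hfin).congr_fun (fun t ht => show f (ρ k) = f t by rw [hdecomp k t]; exact (hf k _ ht.1).symm) (hsm k)

/-! ## 2. The residue field of `F_v` and the character `ψ₀` -/

section Residue

variable (F : Type) [Field F] [NumberField F] (v : HeightOneSpectrum (𝓞 F)) {π : v.adicCompletion F}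

/-- **`|𝓀(F_v)| = q_v`** (★ `AdicCompletionResidueCard`, in the `Valued` spelling of the residue field). [cite: CasselsFrohlichANT1967, Ch. II §10] -/
theorem natCard_residueField_eq : Nat.card 𝓀[v.adicCompletion F] = v.residueCard := by
  rw [HeightOneSpectrum.residueCard_eq_card_quotient]; exact HeightOneSpectrum.natCard_residueField_adicCompletion F v

/-- `𝓀(F_v)` is finite. [cite: CasselsFrohlichANT1967, Ch. II §10] -/
theorem finite_residueField : Finite 𝓀[v.adicCompletion F] :=
  Nat.finite_of_card_ne_zero (by rw [natCard_residueField_eq]; exact (lt_trans zero_lt_one (HeightOneSpectrum.one_lt_residueCard v)).ne')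

/-- discreteness: `|x| < 1 ↔ |x| ≤ |ϖ|`. [cite: CasselsFrohlichANT1967, Ch. II §10] -/
theorem v_lt_one_iff_le (hπ : Valued.v π = WithZero.exp (-1 : ℤ)) (x : v.adicCompletion F) : Valued.v x < 1 ↔ Valued.v x ≤ Valued.v π := by
  rw [hπ]; exact HermitianLattice.v_lt_one_iff x

/-- `ϖ ≠ 0`, `|ϖ| ≠ 0`, `|ϖ| < 1`, `ϖ ∈ 𝒪`. [cite: CasselsFrohlichANT1967, Ch. II §10] -/
theorem uniformizer_facts (hπ : Valued.v π = WithZero.exp (-1 : ℤ)) : π ≠ 0 ∧ Valued.v π ≠ 0 ∧ Valued.v π < 1 ∧ Valued.v π ≤ 1 := by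
  have hlt : Valued.v π < 1 := by rw [hπ, ← WithZero.exp_zero, WithZero.exp_lt_exp]; norm_num
  have h0 : Valued.v π ≠ 0 := by rw [hπ]; exact WithZero.exp_ne_zero
  exact ⟨fun h => h0 (by rw [h, map_zero]), h0, hlt, hlt.le⟩

/-- elements of `𝒪` with the same residue differ by an element of valuation `≤ |ϖ|`, and conversely. [cite: CasselsFrohlichANT1967, Ch. II §10] -/
theorem residue_eq_iff (hπ : Valued.v π = WithZero.exp (-1 : ℤ)) (x y : 𝒪[v.adicCompletion F]) :
    IsLocalRing.residue _ x = IsLocalRing.residue _ y ↔ Valued.v ((x : v.adicCompletion F) - y) ≤ Valued.v π := by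
  rw [← v_lt_one_iff_le F v hπ, ← sub_eq_zero, ← map_sub, UnitaryLatticeTree.residue_eq_zero_iff_v_lt_one]
  rfl

/-- **THE RESIDUE CHARACTER `ψ₀(x̄) = ψ(−2ϖ⁻¹x)`**: for `ψ` of conductor exponent `0` and `2 ∈ 𝒪^×` it is a well-defined NON-TRIVIAL additive character of `𝓀(F_v)`.
[cite: Tate1950, §2.2] -/
theorem exists_addChar_residue (hπ : Valued.v π = WithZero.exp (-1 : ℤ)) {ψ : AddChar (v.adicCompletion F) Circle} (hdψ : ψ.HasConductorExp 0)
    (h2 : Valued.v (2 : v.adicCompletion F) = 1) :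
    ∃ ψ₀ : AddChar 𝓀[v.adicCompletion F] ℂ, ψ₀ ≠ 1 ∧
      ∀ x : 𝒪[v.adicCompletion F], ψ₀ (IsLocalRing.residue _ x) = ((ψ (-(2 * (π⁻¹ * (x : v.adicCompletion F)))) : Circle) : ℂ) := by
  obtain ⟨hπ0, hvπ0, hπlt, hπle⟩ := uniformizer_facts F v hπ
  -- `ψ` is `1` on `𝒪`
  have hone : ∀ z : v.adicCompletion F, Valued.v z ≤ 1 → ψ z = 1 := fun z hz =>
    hdψ.1 z ((mem_primePowBall_adicCompletion_iff v).2 (by rw [neg_zero, WithZero.exp_zero]; exact hz))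
  -- the lift `x ↦ ψ(−2ϖ⁻¹x)` is constant on residue classes
  have hwd : ∀ x y : 𝒪[v.adicCompletion F], IsLocalRing.residue _ x = IsLocalRing.residue _ y →
      ψ (-(2 * (π⁻¹ * (x : v.adicCompletion F)))) = ψ (-(2 * (π⁻¹ * (y : v.adicCompletion F)))) := by
    intro x y hxy
    have hle := (residue_eq_iff F v hπ x y).1 hxy
    rw [← div_eq_one, ← AddChar.map_sub_eq_div]
    apply hone
    rw [show -(2 * (π⁻¹ * (x : v.adicCompletion F))) - -(2 * (π⁻¹ * (y : v.adicCompletion F))) =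
        -(2 * (π⁻¹ * ((x : v.adicCompletion F) - y))) by ring, Valuation.map_neg, map_mul, map_mul, map_inv₀, h2, one_mul]
    exact (inv_mul_le_iff₀ (zero_lt_iff.2 hvπ0)).2 (by rw [mul_one]; exact hle)
  obtain ⟨sec, hsec⟩ : ∃ sec : 𝓀[v.adicCompletion F] → 𝒪[v.adicCompletion F], ∀ a, IsLocalRing.residue _ (sec a) = a :=
    ⟨Function.surjInv IsLocalRing.residue_surjective, Function.surjInv_eq IsLocalRing.residue_surjective⟩
  refine ⟨{ toFun := fun a => ((ψ (-(2 * (π⁻¹ * (sec a : v.adicCompletion F)))) : Circle) : ℂ)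
            map_zero_eq_one' := ?_
            map_add_eq_mul' := ?_ }, ?_, ?_⟩
  · show ((ψ (-(2 * (π⁻¹ * ((sec 0 : 𝒪[v.adicCompletion F]) : v.adicCompletion F)))) : Circle) : ℂ) = 1
    rw [hwd (sec 0) 0 (by rw [hsec, map_zero]), ZeroMemClass.coe_zero, mul_zero, mul_zero, neg_zero, AddChar.map_zero_eq_one, Circle.coe_one]
  · intro a b
    show ((ψ (-(2 * (π⁻¹ * ((sec (a + b) : 𝒪[v.adicCompletion F]) : v.adicCompletion F)))) : Circle) : ℂ) =
      ((ψ (-(2 * (π⁻¹ * ((sec a : 𝒪[v.adicCompletion F]) : v.adicCompletion F)))) : Circle) : ℂ) * ((ψ (-(2 * (π⁻¹ * ((sec b : 𝒪[v.adicCompletion F]) : v.adicCompletion F)))) : Circle) : ℂ)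
    rw [hwd (sec (a + b)) (sec a + sec b) (by rw [hsec, map_add, hsec, hsec]), AddMemClass.coe_add, ← Circle.coe_mul, ← AddChar.map_add_eq_mul]
    congr 2; ring
  · -- non-trivial: `ψ(y) ≠ 1` for some `y ∈ 𝔭^{-1}`; take `x = −ϖ y ∕ 2 ∈ 𝒪`
    obtain ⟨y, hy, hne⟩ := hdψ.2
    rw [mem_primePowBall_adicCompletion_iff, zero_sub, neg_neg] at hy
    have h20 : (2 : v.adicCompletion F) ≠ 0 := fun h => by rw [h, map_zero] at h2; exact zero_ne_one h2
    have hxint : Valued.v (-(π * y) / 2) ≤ 1 := by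
      rw [map_div₀, Valuation.map_neg, map_mul, h2, div_one, hπ]
      calc WithZero.exp (-1 : ℤ) * Valued.v y ≤ WithZero.exp (-1 : ℤ) * WithZero.exp (1 : ℤ) := mul_le_mul' le_rfl hy
        _ = 1 := by rw [← WithZero.exp_add, neg_add_cancel, WithZero.exp_zero]
    rw [AddChar.ne_one_iff]
    refine ⟨IsLocalRing.residue _ ⟨-(π * y) / 2, hxint⟩, ?_⟩
    show ((ψ (-(2 * (π⁻¹ * ((sec (IsLocalRing.residue _ ⟨-(π * y) / 2, hxint⟩) : 𝒪[v.adicCompletion F]) : v.adicCompletion F)))) : Circle) : ℂ) ≠ 1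
    rw [hwd (sec _) ⟨-(π * y) / 2, hxint⟩ (hsec _), show -(2 * (π⁻¹ * ((⟨-(π * y) / 2, hxint⟩ : 𝒪[v.adicCompletion F]) : v.adicCompletion F))) = y by
      show -(2 * (π⁻¹ * (-(π * y) / 2))) = y; field_simp]
    exact fun h => hne (Circle.coe_inj.1 (h.trans Circle.coe_one.symm))
  · intro x
    show ((ψ (-(2 * (π⁻¹ * ((sec (IsLocalRing.residue _ x) : 𝒪[v.adicCompletion F]) : v.adicCompletion F)))) : Circle) : ℂ) = _
    rw [hwd (sec _) x (hsec _)]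

end Residue

/-! ## 3. Two coset computations in `M₂(F_v)` -/

section Cosets

variable (F : Type) [Field F] [NumberField F] (v : HeightOneSpectrum (𝓞 F)) {π : v.adicCompletion F}

/-- `|det Y| ≤ 1` and `|tr(bY)| ≤ 1` for integral `2 × 2` matrices `b`, `Y` over `F_v`. [cite: CasselsFrohlichANT1967, Ch. II §10] -/
theorem valued_det_trace_le_one {b Y : Matrix (Fin 2) (Fin 2) (v.adicCompletion F)} (hb : ∀ i j, Valued.v (b i j) ≤ 1)
    (hY : ∀ i j, Valued.v (Y i j) ≤ 1) : Valued.v Y.det ≤ 1 ∧ Valued.v (Matrix.trace (b * Y)) ≤ 1 := by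
  constructor
  · rw [Matrix.det_fin_two]
    refine (Valuation.map_sub _ _ _).trans (max_le ?_ ?_) <;> rw [map_mul] <;> exact mul_le_one' (hY _ _) (hY _ _)
  · rw [Matrix.trace]
    refine Valuation.map_sum_le _ fun i _ => ?_
    rw [Matrix.diag_apply, Matrix.mul_apply]
    refine Valuation.map_sum_le _ fun k _ => ?_
    rw [map_mul]; exact mul_le_one' (hb _ _) (hY _ _)

/-- scaling: `|det(ϖ⁻¹N)| ≤ |ϖ|⁻¹ ↔ |det N| ≤ |ϖ|` (`2 × 2`). [cite: CasselsFrohlichANT1967, Ch. II §10] -/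
theorem valued_det_smul_inv_le_iff (hπ : Valued.v π = WithZero.exp (-1 : ℤ)) (N : Matrix (Fin 2) (Fin 2) (v.adicCompletion F)) :
    Valued.v (π⁻¹ • N).det ≤ Valued.v π ^ (-1 : ℤ) ↔ Valued.v N.det ≤ Valued.v π := by
  obtain ⟨hπ0, hvπ0, -, -⟩ := uniformizer_facts F v hπ
  have hpos : 0 < Valued.v π := zero_lt_iff.2 hvπ0
  rw [Matrix.det_smul, Fintype.card_fin, _root_.zpow_neg, zpow_one, ← map_inv₀, pow_two, mul_assoc, map_mul, map_mul, map_inv₀,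
    inv_mul_le_iff₀ hpos, mul_inv_cancel₀ hvπ0, inv_mul_le_iff₀ hpos, mul_one]

/-- **the determinant condition on a coset**: for `κ ∈ M₂(𝓀)` with lift `s(κ)` and an integral `H`, `|det(ϖ⁻¹ s(κ) + H)| ≤ |ϖ|⁻¹ ↔ det κ = 0`
(reduce `s(κ) + ϖH` modulo `𝔪`). [cite: KudlaRallis1994, §2] [cite: LidlNiederreiter1997, Ch. 5] -/
theorem valued_det_coset_le_iff (hπ : Valued.v π = WithZero.exp (-1 : ℤ)) (sec : 𝓀[v.adicCompletion F] → 𝒪[v.adicCompletion F])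
    (hsec : ∀ a, IsLocalRing.residue _ (sec a) = a) (κ : Matrix (Fin 2) (Fin 2) 𝓀[v.adicCompletion F])
    {H : Matrix (Fin 2) (Fin 2) (v.adicCompletion F)} (hH : ∀ i j, Valued.v (H i j) ≤ 1) :
    Valued.v (π⁻¹ • (Matrix.of fun i j => ((sec (κ i j) : 𝒪[v.adicCompletion F]) : v.adicCompletion F)) + H).det ≤ Valued.v π ^ (-1 : ℤ) ↔ κ.det = 0 := by
  obtain ⟨hπ0, hvπ0, hπlt, hπle⟩ := uniformizer_facts F v hπ
  -- the integral matrix `M = s(κ) + ϖ H` with `ϖ⁻¹ s(κ) + H = ϖ⁻¹ M` and `M mod 𝔪 = κ`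
  set M : Matrix (Fin 2) (Fin 2) 𝒪[v.adicCompletion F] := fun i j => sec (κ i j) + ⟨π, hπle⟩ * ⟨H i j, hH i j⟩ with hM
  have hMK : π⁻¹ • (Matrix.of fun i j => ((sec (κ i j) : 𝒪[v.adicCompletion F]) : v.adicCompletion F)) + H = π⁻¹ • M.map (algebraMap 𝒪[v.adicCompletion F] (v.adicCompletion F)) := by
    refine Matrix.ext fun i j => ?_
    simp only [Matrix.add_apply, Matrix.smul_apply, Matrix.map_apply, smul_eq_mul, hM, Matrix.of_apply]
    show π⁻¹ * (sec (κ i j) : v.adicCompletion F) + H i j = π⁻¹ * ((sec (κ i j) : v.adicCompletion F) + π * H i j)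
    rw [mul_add, ← mul_assoc, inv_mul_cancel₀ hπ0, one_mul]
  have hMres : M.map (IsLocalRing.residue 𝒪[v.adicCompletion F]) = κ := by
    refine Matrix.ext fun i j => ?_
    rw [Matrix.map_apply, hM]
    show IsLocalRing.residue 𝒪[v.adicCompletion F] (sec (κ i j) + ⟨π, hπle⟩ * ⟨H i j, hH i j⟩) = κ i j
    rw [map_add, map_mul, hsec, (UnitaryLatticeTree.residue_eq_zero_iff_v_lt_one _).2 (show Valued.v π < 1 from hπlt), zero_mul, add_zero]
  rw [hMK, valued_det_smul_inv_le_iff F v hπ, ← RingHom.mapMatrix_apply, ← RingHom.map_det, ← v_lt_one_iff_le F v hπ,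
    show algebraMap 𝒪[v.adicCompletion F] (v.adicCompletion F) M.det = ((M.det : 𝒪[v.adicCompletion F]) : v.adicCompletion F) from rfl, ← UnitaryLatticeTree.residue_eq_zero_iff_v_lt_one,
    RingHom.map_det, RingHom.mapMatrix_apply, hMres]

/-- **the integrand on a coset**: for integral `b = b_𝒪` and `H`, `ψ(−2 tr(b(ϖ⁻¹ s(κ) + H))) = ψ₀(tr(b̄ κ))` where `ψ₀(x̄) = ψ(−2ϖ⁻¹x)` and `b̄ = b mod 𝔪`
(`ψ` is trivial on `𝒪`). [cite: Tate1950, §2.2] [cite: KudlaRallis1994, §2] -/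
theorem addChar_trace_coset_eq {ψ : AddChar (v.adicCompletion F) Circle} (hdψ : ψ.HasConductorExp 0) (h2 : Valued.v (2 : v.adicCompletion F) = 1)
    {ψ₀ : AddChar 𝓀[v.adicCompletion F] ℂ} (hψ₀ : ∀ x : 𝒪[v.adicCompletion F], ψ₀ (IsLocalRing.residue _ x) = ((ψ (-(2 * (π⁻¹ * (x : v.adicCompletion F)))) : Circle) : ℂ))
    (sec : 𝓀[v.adicCompletion F] → 𝒪[v.adicCompletion F]) (hsec : ∀ a, IsLocalRing.residue _ (sec a) = a) (κ : Matrix (Fin 2) (Fin 2) 𝓀[v.adicCompletion F])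
    (bO : Matrix (Fin 2) (Fin 2) 𝒪[v.adicCompletion F]) {H : Matrix (Fin 2) (Fin 2) (v.adicCompletion F)} (hH : ∀ i j, Valued.v (H i j) ≤ 1) :
    ((ψ (-(2 * Matrix.trace (bO.map (algebraMap 𝒪[v.adicCompletion F] (v.adicCompletion F)) * (π⁻¹ • (Matrix.of fun i j => ((sec (κ i j) : 𝒪[v.adicCompletion F]) : v.adicCompletion F)) + H)))) : Circle) : ℂ) =
      ψ₀ (Matrix.trace (bO.map (IsLocalRing.residue 𝒪[v.adicCompletion F]) * κ)) := by
  have hone : ∀ z : v.adicCompletion F, Valued.v z ≤ 1 → ψ z = 1 := fun z hz =>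
    hdψ.1 z ((mem_primePowBall_adicCompletion_iff v).2 (by rw [neg_zero, WithZero.exp_zero]; exact hz))
  have hbint : ∀ i j, Valued.v (bO.map (algebraMap 𝒪[v.adicCompletion F] (v.adicCompletion F)) i j) ≤ 1 := fun i j => (bO i j).2
  -- traces commute with `𝒪 → F_v` and `𝒪 → 𝓀`
  have hK : ∀ M : Matrix (Fin 2) (Fin 2) 𝒪[v.adicCompletion F], Matrix.trace (M.map (algebraMap 𝒪[v.adicCompletion F] (v.adicCompletion F))) = algebraMap 𝒪[v.adicCompletion F] (v.adicCompletion F) (Matrix.trace M) :=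
    fun M => by rw [AddMonoidHom.map_trace (algebraMap 𝒪[v.adicCompletion F] (v.adicCompletion F)) M]
  have hk : ∀ M : Matrix (Fin 2) (Fin 2) 𝒪[v.adicCompletion F], Matrix.trace (M.map (IsLocalRing.residue 𝒪[v.adicCompletion F])) = IsLocalRing.residue 𝒪[v.adicCompletion F] (Matrix.trace M) :=
    fun M => by rw [AddMonoidHom.map_trace (IsLocalRing.residue 𝒪[v.adicCompletion F]) M]
  -- split the trace
  have hsplit : Matrix.trace (bO.map (algebraMap 𝒪[v.adicCompletion F] (v.adicCompletion F)) * (π⁻¹ • (Matrix.of fun i j => ((sec (κ i j) : 𝒪[v.adicCompletion F]) : v.adicCompletion F)) + H)) =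
      π⁻¹ * ((Matrix.trace (bO * Matrix.of fun i j => sec (κ i j)) : 𝒪[v.adicCompletion F]) : v.adicCompletion F) + Matrix.trace (bO.map (algebraMap 𝒪[v.adicCompletion F] (v.adicCompletion F)) * H) := by
    rw [Matrix.mul_add, Matrix.trace_add, Matrix.mul_smul, Matrix.trace_smul, smul_eq_mul,
      show (Matrix.of fun i j => ((sec (κ i j) : 𝒪[v.adicCompletion F]) : v.adicCompletion F)) = (Matrix.of fun i j => sec (κ i j)).map (algebraMap 𝒪[v.adicCompletion F] (v.adicCompletion F)) from rfl, ← Matrix.map_mul, hK]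
    rfl
  rw [hsplit, mul_add, neg_add, AddChar.map_add_eq_mul, Circle.coe_mul, ← hψ₀,
    hone _ (by rw [Valuation.map_neg, map_mul, h2, one_mul]; exact (valued_det_trace_le_one F v hbint hH).2), Circle.coe_one, mul_one,
    ← hk, Matrix.map_mul, show (Matrix.of fun i j => sec (κ i j)).map (IsLocalRing.residue 𝒪[v.adicCompletion F]) = κ from Matrix.ext fun i j => hsec (κ i j)]

end Cosets

end Summit.HodgeConjecture.HodgeConjecture.Cruxes.HLiu418.K2LiuResidueCharacterCosets

end
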